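import Summits.Ventures.QEC.Census.CertCoverBatch
import Summits.Ventures.QEC.Census.BB.A1s_n192_k4_0fa3ae82.CoreDefs
import HarnessLib

set_option Elab.async false
set_option maxRecDepth 200000

/-!
# `[[192,4,18]]` one-level cover certificate — LEVEL-1→0 coset problems 391…400 (problem 1 excluded: `Prob1.lean`) as COMPACT data
(`ProbData`: U, f, σ, y₀, allow; qec-type-10 `CertCoverBatch.mkCoset` rebuilds each `CosetProb` in the kernel) + their verdict
`probsOK cov covR hx hx1 D1 lxd 16` (one `decide +kernel`). qec-search-9 g5 (lead block 170 (0)(c)); data from JSON `level10.problems`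
(sha256 08367568…). Data + decided check; KERNEL.
-/

namespace Summit.Ventures.QEC.Census.A1s_n192_k4_0fa3ae82

open Matrix Summit.Ventures.QEC.Census Literature.InformationTheory.QuantumCodes

/-- Problems 391…400 (10): `⟨U, f, σ, y₀, allow⟩`. -/
def probs07e : List ProbData := [
    ⟨1818138802332866718237952, 0, 0, 0, [0]⟩,
    ⟨1818138838080184465490176, 2, 0, 0, [0]⟩,
    ⟨1818138910700737046841600, 0, 0, 0, [0]⟩,
    ⟨1818139271551631420166400, 0, 0, 0, [0]⟩,
    ⟨1818139705023147093795072, 0, 0, 0, [0]⟩,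
    ⟨1818148098042873100928008, 1, 2199023779841, 36893488147419103232, [0, 256, 281474976710656]⟩,
    ⟨1818148134076046726271762, 0, 4398047690753, 1813388729426904486783280, []⟩,
    ⟨1818148169537525775436808, 0, 2199023779841, 36893488147419103232, [0]⟩,
    ⟨1818148205847793476110344, 1, 2199023779841, 36893488147419103232, [0, 256, 562949953421312]⟩,
    ⟨1818148279317151888704274, 0, 4398047690753, 1818111097594230270329618, [0]⟩]

set_option maxHeartbeats 400000000 in
/-- Every problem of this chunk passes (`mkCoset` elimination + `cosetOKD` + fast `σ` + depth + `BU`-evenness + label checks). -/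
theorem probs07e_ok : probsOK cov covR hx hx1 D1 lxd 16 probs07e = true := by
  decide +kernel

/-- Pointwise form. -/
theorem probs07e_all : ∀ x ∈ probs07e, probOK cov covR hx hx1 D1 lxd 16 x = true := by
  have h := probs07e_ok
  rwa [probsOK, List.all_eq_true] at h

end Summit.Ventures.QEC.Census.A1s_n192_k4_0fa3ae82
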